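import Summits.AtomisticToContinuum.Crystallization.Theorems.PricedLinkCensusTruncatedCensusGapStrainedMarginCert

/-!
# Landscape certificates for the near/far split of `TruncatedCensusGap` — definitions and first kernel run

Route `PricedLinkCensus`, crux `TruncatedCensusGap` (stmt-AtomisticToContinuum-14230), line `near-far-split`
(reshape r2 of lead c5).  The LANDSCAPE PACKAGE N1c — whole-window inequalities on the class sums `F_fcc`,
`F_hcp` of `V_χ` that any future proof of the near half's open core N2′ (`LocalNearPricing`) consumes as
reference margins and strain floors (typed by the N3 worker, briefs/R2-N1c.txt):
(C1) `F_fcc(a,c) − F_hcp(0.977, 0.797) ≥ 19/100000`; (C2) `½(F_fcc + F_hcp)(a,c) − F_hcp(0.977, 0.797) ≥ 19/200000`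
(the mixed-layer margin); (C3/C4) the quadratic floors `F(a,c) − F_hcp(0.977, 0.797) ≥ 5((a − 0.977)² +
(c − 0.797)²) − 10⁻⁶` for `F = F_hcp, F_fcc`; all for `a ∈ [0.93, 1.02]`, `c ∈ [0.78a, 0.86a]`.

This file: the box checker of `…StrainedMarginCertDefs` with the family AND the threshold as parameters
(`famOKθ`, `checkθ`), the MEAN family, and the floor variant (`famOKfloor`, `checkFloor`: the threshold of a
box is `refHi − ε + lam · (max-corner bound of (√u − a₀)² + max-corner bound of (√(ut) − c₀)²)`, valid because
both are quasi-convex in the box variables; square roots again only through the validated bracket `sqrtLo`),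
plus the kernel run of (C1).  Soundness: `…LandscapeCertSound`; further kernel runs: `…LandscapeCertRun{A,B,C}`;
the package in `(a, c)` form: `…LandscapePackage`.
-/

namespace Summit.AtomisticToContinuum.Crystallization.Theorems.PricedLinkCensusTruncatedCensusGap.StrainedMargin

/-- A family passes on a box against the threshold `θ` if its summed lines are `≥ θ` at the four
corners. [folklore] -/
def famOKθ (θ : ℚ) (cls : List (ℚ × ℚ × ℚ)) (u₁ u₂ t₁ t₂ : ℚ) : Bool :=
  decide (θ ≤ linesVal (boxLines cls u₁ u₂ t₁ t₂) u₁ t₁) &&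
    decide (θ ≤ linesVal (boxLines cls u₁ u₂ t₁ t₂) u₁ t₂) &&
    decide (θ ≤ linesVal (boxLines cls u₁ u₂ t₁ t₂) u₂ t₁) &&
    decide (θ ≤ linesVal (boxLines cls u₁ u₂ t₁ t₂) u₂ t₂)

/-- Recursive bisection with fuel for one family against the threshold `θ`. [folklore] -/
def checkθ (θ : ℚ) (cls : List (ℚ × ℚ × ℚ)) : ℕ → ℚ → ℚ → ℚ → ℚ → Bool
  | 0, u₁, u₂, t₁, t₂ => famOKθ θ cls u₁ u₂ t₁ t₂
  | f + 1, u₁, u₂, t₁, t₂ =>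
    famOKθ θ cls u₁ u₂ t₁ t₂ ||
      (checkθ θ cls f u₁ ((u₁ + u₂) / 2) t₁ ((t₁ + t₂) / 2) &&
        checkθ θ cls f u₁ ((u₁ + u₂) / 2) ((t₁ + t₂) / 2) t₂ &&
        checkθ θ cls f ((u₁ + u₂) / 2) u₂ t₁ ((t₁ + t₂) / 2) &&
        checkθ θ cls f ((u₁ + u₂) / 2) u₂ ((t₁ + t₂) / 2) t₂)

/-- The classes of the MEAN family `½ (F_fcc + F_hcp) = e₀ + ½ J₂` (site energy of a "mixed" layer).
[folklore] -/
def MEAN : List (ℚ × ℚ × ℚ) :=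
  [(3, 1, 0), (3, 3, 0), (3, 4, 0), (3, 1 / 3, 1), (3, 4 / 3, 1), (6, 7 / 3, 1), (3 / 2, 1 / 3, 4),
    (3 / 2, 4 / 3, 4), (1 / 2, 0, 4), (3, 1, 4)]

/-- Upper bound of `(√u − 977/1000)²` at a rational `u ≥ 0`. [folklore] -/
def Uval (u : ℚ) : ℚ := u - 2 * (977 / 1000) * sqrtLo u + (977 / 1000) ^ 2

/-- Upper bound of `(√(u t) − 797/1000)²` at rationals `u, t ≥ 0`. [folklore] -/
def Cval (u t : ℚ) : ℚ := u * t - 2 * (797 / 1000) * sqrtLo (u * t) + (797 / 1000) ^ 2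

/-- The floor threshold of a box: `refHi − ε + lam · (corner bound of (√u − a₀)² + corner bound of
(√(ut) − c₀)²)`. [folklore] -/
def thrFloor (lam ε u₁ u₂ t₁ t₂ : ℚ) : ℚ :=
  refHi - ε + lam * (max (Uval u₁) (Uval u₂) + max (Cval u₁ t₁) (Cval u₂ t₂))

/-- A family passes the floor on a box if its summed lines are `≥ thrFloor` at the four corners. [folklore] -/
def famOKfloor (lam ε : ℚ) (cls : List (ℚ × ℚ × ℚ)) (u₁ u₂ t₁ t₂ : ℚ) : Bool :=
  famOKθ (thrFloor lam ε u₁ u₂ t₁ t₂) cls u₁ u₂ t₁ t₂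

/-- Recursive bisection with fuel for the floor. [folklore] -/
def checkFloor (lam ε : ℚ) (cls : List (ℚ × ℚ × ℚ)) : ℕ → ℚ → ℚ → ℚ → ℚ → Bool
  | 0, u₁, u₂, t₁, t₂ => famOKfloor lam ε cls u₁ u₂ t₁ t₂
  | f + 1, u₁, u₂, t₁, t₂ =>
    famOKfloor lam ε cls u₁ u₂ t₁ t₂ ||
      (checkFloor lam ε cls f u₁ ((u₁ + u₂) / 2) t₁ ((t₁ + t₂) / 2) &&
        checkFloor lam ε cls f u₁ ((u₁ + u₂) / 2) ((t₁ + t₂) / 2) t₂ &&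
        checkFloor lam ε cls f ((u₁ + u₂) / 2) u₂ t₁ ((t₁ + t₂) / 2) &&
        checkFloor lam ε cls f ((u₁ + u₂) / 2) u₂ ((t₁ + t₂) / 2) t₂)

/-! ## Kernel run (C1) -/

set_option maxHeartbeats 0 in -- kernel evaluation of a box certificate (no proof search; bounded by the box count)
/-- **KERNEL RUN (C1)** (registered sub-goal `landscapeC1_eq_true`): the `F_fcc` family is
`≥ refHi + 19/100000` on the whole window `u ∈ [0.93², 1.02²]`, `t ∈ [0.78², 0.86²]` (157 boxes). [folklore] -/
theorem landscapeC1_eq_true : checkθ (refHi + 19 / 100000) FCC 9 (8649 / 10000) (10404 / 10000) (6084 / 10000) (7396 / 10000) = true := by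
  decide +kernel

end Summit.AtomisticToContinuum.Crystallization.Theorems.PricedLinkCensusTruncatedCensusGap.StrainedMargin
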